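import Mathlib
import HarnessLib
import HarnessLib.Audit
import Summits.RiemannHypothesis.Statement
import HarnessLib.Audit.Check
import HarnessLib.Audit.Status.Attr

/-!
Route: EvenSectorBarta

# Route EvenSectorBarta — one-signed even Weil bottom states plus the explicit even theta-vector
Barta floor decide RH

It suffices to show X = X2 ∧ X3 (with two provable-now supports): (X2, deciding) beyond every height
A there is a window
a ≥ A whose EVEN-sector bottom state u of Weil's quadratic form Q (an L²-limit of a minimising
sequence of even, L²-normalised
smooth tests supported in [−a, a]) is real and one-signed a.e. on (−a, a); (X3) at every window a >
0 carrying such a one-signed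
even bottom state, every even normalised window test h has Re Q h ≥ −e(a), with the EXPLICIT Barta
rate
e(a) = 2ϖ_a cosh(a/2)/Φ(a), ϖ_a = ∫_(s>a) Φ(s)·2cosh(s/2) ds, Φ = Riemann's theta kernel in Weil's
additive variable.
With e(a) → 0 (support EvenFloorDecay) and "¬RH ⇒ even window energies eventually ≤ −η < 0" (support
EvenNegativityOffLine,
the in-tree even Weil criterion) the four are contradictory unless RH. Realises sketch
even-sector-barta (markdown wave).
Lean: `EvenBartaFloor ∧ EvenFloorDecay ∧ EvenOneSignedWindows ∧ EvenNegativityOffLine`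

## Assembly
Pure logic (by contradiction): ¬RH gives η > 0 and even tests with Re Q h ≤ −η on all large windows
(EvenNegativityOffLine);
EvenFloorDecay gives e(a) < η for large a; EvenOneSignedWindows gives a one-signed even bottom state
at some such large a ≥ 1;
EvenBartaFloor at that window gives −e(a) ≤ Re Q h ≤ −η < −e(a), absurd. The deciding theorem
`closes` in glue.lean is this
argument (15 lines, kernel-checked in Sketch.lean).

Rationale: WHY THIS LINE. Mechanism: Barta's supersolution inequality (a one-signed ground state u and a
positive trial vector K with "HK ≥ −eK" on the
window give λ₀ ≥ −e by pairing, [corpus:paper:arxiv-math_0609495 p.5 Thm 2.1] = Barta 1937)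
transplanted to the NON-LOCAL Weil
form: the trial vector is the even theta vector K_a = Φ·𝟙_[−a,a], whose Weil image is computed in
closed form by the explicit
formula (polar term −2ϖ_a cosh(t/2), prime and archimedean layers ≥ 0), so the floor −e(a) is
explicit and decays like the
Φ-tail. Imported from spectral theory / calculus of variations: Barta–Picone pairing,
Perron–Frobenius for positivity-improving
Markov parts (Bombieri2000Weil §4 variational problem; doi:10.1002/cpa.10089), prolate heuristics
for the bottom eigenvector
(arXiv:2106.01715 §2.5, §3; arXiv:2511.22755 §7–8). What it does that prior routes do not:
route-RiemannHypothesis-GroundBarta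
needs the parity-order crux EvenWinsBeyondArch and the odd detour, route-RiemannHypothesis-OddSector
faces the origin cusp of the
odd sector, route-RiemannHypothesis-WeilGroundState needs simple-even at EVERY window plus Connes'
limit formula; here the even
sector is attacked directly, parity-free, with strictly weaker hypotheses, and the negatives index
(CharacterSums, UniversalFactor)
is untouched.

RANKED CRUXES. #2 EvenOneSignedWindows (crux) — for every A there is a window a ≥ A and an
even-sector bottom state u at a (MemLp u 2; L²-limit of a minimising sequence of even smooth
L²-normalised tests supported in [−a,a] for Re Q over that class) with Im u = 0 and Re u ≥ 0 a.e. on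
(−a, a). Sketch item #2 (2001 wall W-POS′, ∃-over-windows form). [difficulty: XL] (why it might
fail: at large a the rank-one polar part 2|ch⟩⟨ch| competes with the positivity-improving Markov
part; the even bottom eigenvector may change sign in the bulk at non-resonant windows (no sign
theorem at ANY window in print), killing the a.e. form.) [Bombieri2000Weil, doi:10.1002/cpa.10089,
arXiv:2106.01715, arXiv:2511.22755, arXiv:2606.09096, arXiv:1511.05294]
#3 EvenBartaFloor (crux) — for every a > 0, if some even-sector bottom state at a is real and
nonnegative a.e. on (−a,a), then every even L²-normalised smooth test h supported in [−a,a] has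
−e(a) ≤ Re Q h, where e(a) = 2(∫_(s>a) Φ(s)·2cosh(s/2) ds)·cosh(a/2)/Φ(a) and Φ is the printed theta
series (= weilThetaPhi). Sketch item #3 (explicit per-window form, lesson F1 of the GroundBartaFloor
attack). [difficulty: L] (why it might fail: the transport identity W(g ⋆ K̃_a) = ∫ g·(image of K_a)
needs the explicit formula for the non-smooth vector Φ𝟙_[−a,a] (jump at ±a) and an L² Euler–Lagrange
limit for the bottom state; a boundary term or a wrong sign in the archimedean layer breaks the
stated constant.) [Bombieri2000Weil, arXiv:math/0609495, doi:10.1016/j.dam.2007.05.013,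
Yoshida1992HermitianForms]
#9 EvenFloorDecay (support) — the explicit Barta rate e(a) = 2ϖ_a cosh(a/2)/Φ(a) tends to 0 as a → ∞
(Φ-tail ratio bounds: ϖ_a ≲ e^(−3a/2)·Φ(a)-type estimates, as the odd phiRatio lemmas). [difficulty:
M] [arXiv:2106.01715, Bombieri2000Weil]
#9 EvenNegativityOffLine (support) — if RH fails there are η > 0 and A such that every window a ≥ A
carries an even L²-normalised smooth test h supported in [−a,a] with Re Q h ≤ −η (provable now from
the in-tree even Weil criterion riemannHypothesis_iff_evenWeilPositivity and antitonicity of window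
energies). [difficulty: provable-now] [Yoshida1992HermitianForms, Bombieri2000Weil]

TWO-LAYER PLAN. EvenOneSignedWindows ⇐ (bulk smallness of the negative part of real even bottom
states beyond some height, ∀θ>0) → (rigidity:
∃θ>0, cofinally in a, negative part < θ forces Re u ≥ 0 a.e.) → EvenOneSignedWindows (registered
birth skeleton, 2 stubs).
EvenBartaFloor ⇐ (transport identity for K_a) → (L² membership of the image on the window) →
(Euler–Lagrange limit of the
minimising sequence paired with K_a) → EvenBartaFloor (registered birth skeleton, 3 stubs; the Barta
pairing itself is proved there).

KILL CRITERIA. A certified Galerkin enclosure showing a bulk sign change of the bottom even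
eigenvector at a cofinal family of windows refutes
EvenOneSignedWindows as typed (close --reason refuted:EvenOneSignedWindows, or pivot to the
pre-declared BULK form W-POS⁻ of the
sketch); a window a with a one-signed even bottom state and an even normalised h with Re Q h < −e(a)
refutes EvenBartaFloor
(misstated constant ⇒ restate with the corrected archimedean layer). RH proved elsewhere moots the
route; GroundBarta's
PolarPerronFrobenius proved at all large windows implies EvenOneSignedWindows and merges the two
routes.

NOT DECOMPOSED YET. The Φ-tail ratio constants behind EvenFloorDecay, the exact regularity class of
the bottom state (continuity on the open window),
the resonance set of windows near prime-power logarithms, and the small-window sign rung (first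
prover target, BC5 plan-only) are
layer-2 children; no third layer will be filed.

CHEAPEST FALSIFIER. Float Galerkin of the even block σ⁺ (trigonometric basis of arXiv:2106.01715
§2.2, N ≈ 150) at three non-resonant windows
e^a ∈ [5, 27]: plot the bottom even eigenvector; one interior sign change at consecutive windows
kills the a.e. form of
EvenOneSignedWindows within a day (kit job, not yet run by this seat); and e(1), e(2) (= 0.116,
0.028 by the seat's quadrature)
against the computed bottom even energies tests EvenBartaFloor numerically.

NUMBERS. e(0.5) ≈ 0.2956, e(1) ≈ 0.1164, e(2) ≈ 0.0280 (seat quadrature of the printed series, 40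
terms); window positivity is a theorem
in the tree for a ≤ (log 3)/2 (weilPositivityOn_log_three_half) and reported numerically far beyond
(arXiv:2106.01715 §2: smallest
even eigenvalue < 6·10⁻⁸ at e^a-scale μ = 3 and exponentially small beyond).

DEFINITION REQUESTS. IsWeilEvenGroundState a u (topic Literature/NumberTheory/LFunctions; the even
twin of IsWeilOddGroundState — the clause inlined in
items #2/#3; filed after open so provers share one predicate). No cite facts needed: the even
criterion is in-tree.

Novelty: Searches (2026-08-17): lit search --hybrid "Barta inequality ground state lower bound supersolution"
(8 book hits, PDE comparison
theory only); lit search "Barta eigenvalue" --source local (10 hits: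
[corpus:paper:arxiv-math_0609495 p.5 Thm 2.1] Barta 1937,
[corpus:paper:doi-10-1016-j-dam-2007-05-013 p.12] discrete Barta — the LOCAL operator versions); lit
vsearch "<EvenOneSignedWindows in
prose>" -k 10 (no relevant hit); lit search "Weil positivity prolate" --source local (12 hits:
[corpus:paper:arxiv-2106.01715 p.8 L93,
p.10 §2.5, p.12] even/odd split σ±, smallest-eigenvalue numerics, bottom eigenvectors ≈ prolate ε_n;
[corpus:paper:arxiv-2511.22755
p.2 Thm 1.1, p.18 Def 5.3 "even-simple", p.34 §8 "missing steps"]; [corpus:paper:arxiv-2511.23257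
p.3]); lit galaxy search
"Weil positivity|Weil's positivity|semi-local Weil|semilocal Weil" --star all
([galaxy:pdf:3980432541385943080] Nakamura–Suzuki,
infinite divisibility — unrelated to signs; panama queue saturated, crabby 0); lit galaxy search
"Barta's inequality|Barta
inequality|Barta's theorem" --star all (rc 1 queue saturated — null recorded); ledger negatives (2,
unrelated); lean search for
even theta-vector / even floor decls (none: only odd `weilOddTheta*`, `GroundBartaFloor`).
Nearest prior art found: arXiv:2511.22755 §8 (Connes–Consani–Moscovici name "smallest eigenvalue of
QW_λ simple with EVEN
eigenvector" as missing step 1 of their tentative proof and close through regularised determinants +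
prolate approximation);  [refs: 10.1002/cpa.10089, 2511.22755, 2106.01715, paper:arxiv-math_0609495, paper:doi-10-1016-j-dam-2007-05-013, paper:arxiv-2106.01715, paper:arxiv-2511.22755, paper:arxiv-2511.23257, doi:10.1002/cpa.10089]

Barriers (technique_class: Weil-positivity, Barta-supersolution, ground-state-sign, PF): - technique_class: Weil-positivity, Barta-supersolution, ground-state-sign, PF
- Literature.Barriers.RiemannHypothesis.DeBrangesPositivity: outside — the functional is Weil's
explicit-formula form on compactly supported tests (window positivity ⟸ RH by Weil–Bombieri, so it
cannot fail the way (3.1)/(3.3) of Conrey–Li fail); no de Branges space or kernel K(w,z) is used.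
- Literature.Barriers.RiemannHypothesis.DavenportHeilbronn: outside — Q carries the von Mangoldt
coefficients (Euler product used: the prime layer of the K_a-image is ≥ 0 BECAUSE Λ ≥ 0) and the
floor uses Φ (functional equation); for a Davenport–Heilbronn-type form neither EvenOneSignedWindows
nor positivity of the prime layer is claimed.
- Literature.Barriers.RiemannHypothesis.RamanujanAxiomNecessity: not evaded by structure — the
cruxes are ζ-specific quantitative statements (Λ(n), digamma, Φ), which is exactly what the barrier
demands; the bet is that the PF-vs-polar competition is decided by ζ's actual prime weights.
- Literature.Barriers.RiemannHypothesis.DiamondMontgomeryVorhauer2006_thm1: outside (Beurling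
counterexamples) — the archimedean digamma layer and Φ (hence the functional equation) are
load-bearing; no Beurling system shares them.
- Literature.Barriers.RiemannHypothesis.NewmanConjecture: outside — no backward heat flow /
universal factor; the floor is margin-free (−e(a) → 0 and a sign, not a zero-gap).
- Literature.Barriers.RiemannHypothesis.LiouvilleSignConjectures: inside the broad "one-signe

sub-problem: RiemannHypothesis · status: draft · opened planner-type-8f6141a64e-0 2026-08-17T19:02:55Z · rev 0 · ledger route-RiemannHypothesis-EvenSectorBarta
GENERATED by the gate from the ledger (D-0016/17). Provers cite these decls: `theorem foo : Summit.RiemannHypothesis.RiemannHypothesis.Theses.EvenSectorBarta.<Decl> := …` in Summits/RiemannHypothesis/RiemannHypothesis/Theorems/<Name>.lean.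
-/

namespace Summit.RiemannHypothesis.RiemannHypothesis.Theses.EvenSectorBarta

open scoped BigOperators Topology Manifold Classical MeasureTheory ProbabilityTheory Matrix InnerProductSpace ComplexConjugate ContinuousMap
open Filter Set Function TopologicalSpace MeasureTheory

attribute [summit_statement] _root_.Summit.RiemannHypothesis

open Summit

/-- item stmt-RiemannHypothesis-19953 · crux · rank 2 · open · by planner
why it might fail: at large a the rank-one polar part 2|ch⟩⟨ch| competes with the positivity-improving Markov part; the even bottom eigenvector may change sign in the bulk at non-resonant windows (no sign theorem at ANY window in print), killing the a.e. form.
sources: Bombieri2000Weil, doi:10.1002/cpa.10089, arXiv:2106.01715, arXiv:2511.22755, arXiv:2606.09096, arXiv:1511.05294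
[crux] for every A there is a window a ≥ A and an even-sector bottom state u at a (MemLp u 2;
L²-limit of a minimising sequence of even smooth L²-normalised tests supported in [−a,a] for Re Q
over that class) with Im u = 0 and Re u ≥ 0 a.e. on (−a, a). Sketch item #2 (2001 wall W-POS′,
∃-over-windows form). [difficulty: XL] -/
@[route_item "route-RiemannHypothesis-EvenSectorBarta", crux]
def EvenOneSignedWindows : Prop :=
  let C : (ℝ → ℂ) → ℝ → ℂ := fun g => MeasureTheory.convolution g (fun t => (starRingEnd ℂ) (g (-t))) (ContinuousLinearMap.mul ℂ ℂ) MeasureTheory.MeasureSpace.volume; let M : (ℝ → ℂ) → ℂ → ℂ := fun F s => ∫ t : ℝ, F t * Complex.exp ((s - 1 / 2) * t); let Q : (ℝ → ℂ) → ℂ := fun g => M (C g) 0 + M (C g) 1 - (∑' n : ℕ, ((ArithmeticFunction.vonMangoldt n : ℝ) : ℂ) / (Real.sqrt n : ℂ) * (C g (Real.log n) + C g (-Real.log n))) + ((1 / (2 * Real.pi) : ℂ) * (∫ t : ℝ, M (C g) (1 / 2 + t * Complex.I) * ((Complex.digamma (1 / 4 + t / 2 * Complex.I)).re : ℂ)) -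 C g 0 * (Real.log Real.pi : ℂ)); ∀ A : ℝ, ∃ a : ℝ, A ≤ a ∧ ∃ u : ℝ → ℂ, (MeasureTheory.MemLp u 2 ∧ ∃ g : ℕ → ℝ → ℂ, (∀ n, (ContDiff ℝ ((⊤ : ℕ∞) : WithTop ℕ∞) (g n) ∧ HasCompactSupport (g n)) ∧ tsupport (g n) ⊆ Set.Icc (-a) a ∧ (∀ t, g n (-t) = g n t) ∧ ∫ t, ‖g n t‖ ^ 2 = (1 : ℝ)) ∧ (∀ h : ℝ → ℂ, (ContDiff ℝ ((⊤ : ℕ∞) : WithTop ℕ∞) h ∧ HasCompactSupport h) → tsupport h ⊆ Set.Icc (-a) a → (∀ t, h (-t) = h t) → ∫ t, ‖h t‖ ^ 2 = (1 : ℝ) → ∀ δ : ℝ, 0 < δ → ∀ᶠ n in Filter.atTop, (Q (g n)).re ≤ (Q h).re + δ) ∧ Filter.Tendsto (fun n => ∫ t, ‖g n t - u t‖ ^ 2) Filter.atTop (nhds 0)) ∧ (∀ᵐ t : ℝ, t ∈ Set.Ioo (-a) a → (u t).im = 0 ∧ 0 ≤ (u t).re)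

/-- item stmt-RiemannHypothesis-19954 · crux · rank 3 · closed · proved by Summit.RiemannHypothesis.RiemannHypothesis.Theorems.EvenSectorBarta.evenBartaFloor_proof @ 8f0399d95571 (prover) · by planner
why it might fail: the transport identity W(g ⋆ K̃_a) = ∫ g·(image of K_a) needs the explicit formula for the non-smooth vector Φ𝟙_[−a,a] (jump at ±a) and an L² Euler–Lagrange limit for the bottom state; a boundary term or a wrong sign in the archimedean layer breaks the stated constant.
sources: Bombieri2000Weil, arXiv:math/0609495, doi:10.1016/j.dam.2007.05.013, Yoshida1992HermitianForms
[crux] for every a > 0, if some even-sector bottom state at a is real and nonnegative a.e. on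
(−a,a), then every even L²-normalised smooth test h supported in [−a,a] has −e(a) ≤ Re Q h, where
e(a) = 2(∫_(s>a) Φ(s)·2cosh(s/2) ds)·cosh(a/2)/Φ(a) and Φ is the printed theta series (=
weilThetaPhi). Sketch item #3 (explicit per-window form, lesson F1 of the GroundBartaFloor attack).
[difficulty: L] -/
@[route_item "route-RiemannHypothesis-EvenSectorBarta", crux]
def EvenBartaFloor : Prop :=
  let C : (ℝ → ℂ) → ℝ → ℂ := fun g => MeasureTheory.convolution g (fun t => (starRingEnd ℂ) (g (-t))) (ContinuousLinearMap.mul ℂ ℂ) MeasureTheory.MeasureSpace.volume; let M : (ℝ → ℂ) → ℂ → ℂ := fun F s => ∫ t : ℝ, F t * Complex.exp ((s - 1 / 2) * t); let Q : (ℝ → ℂ) → ℂ := fun g => M (C g) 0 + M (C g) 1 - (∑' n : ℕ, ((ArithmeticFunction.vonMangoldt n : ℝ) : ℂ) / (Real.sqrt n : ℂ) * (C g (Real.log n) + C g (-Real.log n))) + ((1 / (2 * Real.pi) : ℂ) * (∫ t : ℝ, M (C g) (1 / 2 + t * Complex.I) * ((Complex.digamma (1 / 4 + t / 2 * Complex.I)).re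 : ℂ)) - C g 0 * (Real.log Real.pi : ℂ)); let Φ : ℝ → ℝ := fun t => ∑' n : ℕ, (4 * Real.pi ^ 2 * ((n : ℝ) + 1) ^ 4 * Real.exp (9 / 2 * t) - 6 * Real.pi * ((n : ℝ) + 1) ^ 2 * Real.exp (5 / 2 * t)) * Real.exp (-(Real.pi * ((n : ℝ) + 1) ^ 2 * Real.exp (2 * t))); let e : ℝ → ℝ := fun a => 2 * (∫ s in Set.Ioi a, Φ s * (2 * Real.cosh (s / 2))) * Real.cosh (a / 2) / Φ a; ∀ a : ℝ, 0 < a → (∃ u : ℝ → ℂ, (MeasureTheory.MemLp u 2 ∧ ∃ g : ℕ → ℝ → ℂ, (∀ n, (ContDiff ℝ ((⊤ : ℕ∞) : WithTop ℕ∞) (g n) ∧ HasCompactSupport (g n)) ∧ tsupport (g n) ⊆ Set.Icc (-a) a ∧ (∀ t, g n (-t) = g n t) ∧ ∫ t, ‖g n t‖ ^ 2 = (1 : ℝ)) ∧ (∀ h : ℝ → ℂ, (ContDiff ℝ ((⊤ : ℕ∞) : WithTop ℕ∞) h ∧ HasCompactSupport h) → tsupport h ⊆ Set.Icc (-a) a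 → (∀ t, h (-t) = h t) → ∫ t, ‖h t‖ ^ 2 = (1 : ℝ) → ∀ δ : ℝ, 0 < δ → ∀ᶠ n in Filter.atTop, (Q (g n)).re ≤ (Q h).re + δ) ∧ Filter.Tendsto (fun n => ∫ t, ‖g n t - u t‖ ^ 2) Filter.atTop (nhds 0)) ∧ (∀ᵐ t : ℝ, t ∈ Set.Ioo (-a) a → (u t).im = 0 ∧ 0 ≤ (u t).re)) → ∀ h : ℝ → ℂ, (ContDiff ℝ ((⊤ : ℕ∞) : WithTop ℕ∞) h ∧ HasCompactSupport h) → tsupport h ⊆ Set.Icc (-a) a → (∀ t, h (-t) = h t) → ∫ t, ‖h t‖ ^ 2 = (1 : ℝ) → -e a ≤ (Q h).re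

/-- item stmt-RiemannHypothesis-19955 · support · rank 9 · closed · proved by Summit.RiemannHypothesis.RiemannHypothesis.Theorems.EvenSectorBarta.evenFloorDecay_proof @ 8f0399d95571 (prover) · by planner
sources: arXiv:2106.01715, Bombieri2000Weil
[support] the explicit Barta rate e(a) = 2ϖ_a cosh(a/2)/Φ(a) tends to 0 as a → ∞ (Φ-tail ratio
bounds: ϖ_a ≲ e^(−3a/2)·Φ(a)-type estimates, as the odd phiRatio lemmas). [difficulty: M] -/
@[route_item "route-RiemannHypothesis-EvenSectorBarta", crux]
def EvenFloorDecay : Prop :=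
  let Φ : ℝ → ℝ := fun t => ∑' n : ℕ, (4 * Real.pi ^ 2 * ((n : ℝ) + 1) ^ 4 * Real.exp (9 / 2 * t) - 6 * Real.pi * ((n : ℝ) + 1) ^ 2 * Real.exp (5 / 2 * t)) * Real.exp (-(Real.pi * ((n : ℝ) + 1) ^ 2 * Real.exp (2 * t))); let e : ℝ → ℝ := fun a => 2 * (∫ s in Set.Ioi a, Φ s * (2 * Real.cosh (s / 2))) * Real.cosh (a / 2) / Φ a; Filter.Tendsto e Filter.atTop (nhds 0)

/-- item stmt-RiemannHypothesis-19956 · support · rank 9 · closed · proved by Summit.RiemannHypothesis.RiemannHypothesis.Theorems.EvenSectorBarta.evenNegativityOffLine_proof @ 8f0399d95571 (prover) · by planner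
sources: Yoshida1992HermitianForms, Bombieri2000Weil
[support] if RH fails there are η > 0 and A such that every window a ≥ A carries an even
L²-normalised smooth test h supported in [−a,a] with Re Q h ≤ −η (provable now from the in-tree even
Weil criterion riemannHypothesis_iff_evenWeilPositivity and antitonicity of window energies).
[difficulty: provable-now] -/
@[route_item "route-RiemannHypothesis-EvenSectorBarta", crux]
def EvenNegativityOffLine : Prop :=
  let C : (ℝ → ℂ) → ℝ → ℂ := fun g => MeasureTheory.convolution g (fun t => (starRingEnd ℂ) (g (-t))) (ContinuousLinearMap.mul ℂ ℂ) MeasureTheory.MeasureSpace.volume; let M : (ℝ → ℂ) → ℂ → ℂ := fun F s => ∫ t : ℝ, F t * Complex.exp ((s - 1 / 2) * t); let Q : (ℝ → ℂ) → ℂ := fun g => M (C g) 0 + M (C g) 1 - (∑' n : ℕ, ((ArithmeticFunction.vonMangoldt n : ℝ) : ℂ) / (Real.sqrt n : ℂ) * (C g (Real.log n) + C g (-Real.log n))) + ((1 / (2 * Real.pi) : ℂ) * (∫ t : ℝ, M (C g) (1 / 2 + t * Complex.I) * ((Complex.digamma (1 / 4 + t / 2 * Complex.I)).re : ℂ)) -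 C g 0 * (Real.log Real.pi : ℂ)); ¬ RiemannHypothesis → ∃ η : ℝ, 0 < η ∧ ∃ A : ℝ, ∀ a : ℝ, A ≤ a → ∃ h : ℝ → ℂ, (ContDiff ℝ ((⊤ : ℕ∞) : WithTop ℕ∞) h ∧ HasCompactSupport h) ∧ tsupport h ⊆ Set.Icc (-a) a ∧ (∀ t, h (-t) = h t) ∧ ∫ t, ‖h t‖ ^ 2 = (1 : ℝ) ∧ (Q h).re ≤ -η

/-- item stmt-RiemannHypothesis-19958 · aside · rank 9 · open · by planner
sources: arXiv:2106.01715, Bombieri2000Weil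
[aside] banked context, never staffed: Weil positivity on the window a = 1 (every smooth test
supported in [−1,1] has Re Q ≥ 0) — OPEN (the tree proves a ≤ (log 3)/2 only); present solely as the
tribunal s_case naming the S-restricted regime in which the BC5 witness must NOT already be a
theorem. -/
@[route_item "route-RiemannHypothesis-EvenSectorBarta"]
def WindowPositivityAtOne : Prop :=
  let C : (ℝ → ℂ) → ℝ → ℂ := fun g => MeasureTheory.convolution g (fun t => (starRingEnd ℂ) (g (-t))) (ContinuousLinearMap.mul ℂ ℂ) MeasureTheory.MeasureSpace.volume; let M : (ℝ → ℂ) → ℂ → ℂ := fun F s => ∫ t : ℝ, F t * Complex.exp ((s - 1 / 2) * t); let Q : (ℝ → ℂ) → ℂ := fun g => M (C g) 0 + M (C g) 1 - (∑' n : ℕ, ((ArithmeticFunction.vonMangoldt n : ℝ) : ℂ) / (Real.sqrt n : ℂ) * (C g (Real.log n) + C g (-Real.log n))) + ((1 / (2 * Real.pi) : ℂ) * (∫ t : ℝ, M (C g) (1 / 2 + t * Complex.I) * ((Complex.digamma (1 / 4 + t / 2 * Complex.I)).re : ℂ)) - C g 0 * (Real.log Real.pi : ℂ)); ∀ h : ℝ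 → ℂ, (ContDiff ℝ ((⊤ : ℕ∞) : WithTop ℕ∞) h ∧ HasCompactSupport h) → tsupport h ⊆ Set.Icc (-1) 1 → 0 ≤ (Q h).re

/-- item stmt-RiemannHypothesis-19957 · assembly · rank 1 · closed · proved by Summit.RiemannHypothesis.RiemannHypothesis.Theorems.EvenSectorBarta.assembly_proof @ 8f0399d95571 (prover) · by planner
sources: Bombieri2000Weil
[assembly] EvenBartaFloor → EvenFloorDecay → EvenOneSignedWindows → EvenNegativityOffLine → RH -/
@[route_item "route-RiemannHypothesis-EvenSectorBarta"]
def Assembly : Prop :=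
  EvenBartaFloor → EvenFloorDecay → EvenOneSignedWindows → EvenNegativityOffLine → Summit.RiemannHypothesis

/-! D-0027 §2.1 — DECIDING THEOREM (planner-authored via `route open/edit --closes-file`; by planner-type-8f6141a64e-0 2026-08-17T19:02:56Z):
its hypotheses are this route's items and its conclusion the sub-problem Statement (glue_lint), and it elaborates with this file. -/

/-- DECIDING THEOREM (D-0027 §2.1): the explicit even Barta floor, the decay of its rate, one-signed even-sector
bottom states beyond every height, and even negativity off the line are jointly contradictory unless RH holds. -/
@[closes "route-RiemannHypothesis-EvenSectorBarta"] theorem closes (hFloor : EvenBartaFloor) (hDecay : EvenFloorDecay) (hPos : EvenOneSignedWindows)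
    (hNeg : EvenNegativityOffLine) : _root_.Summit.RiemannHypothesis := by
  show _root_.RiemannHypothesis
  by_contra hRH
  obtain ⟨η, hη, A, hAneg⟩ := hNeg hRH
  have hev := Filter.Tendsto.eventually hDecay (Iio_mem_nhds hη)
  obtain ⟨A₁, hA₁⟩ := Filter.eventually_atTop.1 hev
  obtain ⟨a, ha, u, hu, hsign⟩ := hPos (max (max A A₁) 1)
  have haA : A ≤ a := le_trans (le_trans (le_max_left _ _) (le_max_left _ _)) ha
  have haA₁ : A₁ ≤ a := le_trans (le_trans (le_max_right _ _) (le_max_left _ _)) ha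
  have ha1 : (1 : ℝ) ≤ a := le_trans (le_max_right _ _) ha
  have ha0 : (0 : ℝ) < a := lt_of_lt_of_le one_pos ha1
  obtain ⟨h, hh, hsupp, heven, hnorm, hneg⟩ := hAneg a haA
  have h1 := hFloor a ha0 ⟨u, hu, hsign⟩ h hh hsupp heven hnorm
  have h2 := hA₁ a haA₁
  have h2' : _ < η := h2
  have h3 := le_trans h1 hneg
  linarith

end Summit.RiemannHypothesis.RiemannHypothesis.Theses.EvenSectorBarta
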